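import Mathlib
import Summits.NavierStokesRegularity.NavierStokesRegularity.Theorems.WakeRatchetTailTools
import Summits.NavierStokesRegularity.NavierStokesRegularity.Theses.WakeRatchet
import HarnessLib

/-!
# `WakeRatchet.TailRatchet` (stmt-NavierStokesRegularity-21808, ASIDE) — its position in the route BY NAME,
# and the finite-energy Liouville reading of every tail ratchet

Two pieces of bookkeeping for the planner of route `WakeRatchet`, both about uniformly bounded admissible
eternal solutions `W` of the renormalised Tao-type MODEL lattice (`IsEternalVisc ε₀ ν̂ α W`, `UniformBound W`,
tail energies `Θ_n(σ) = Σ_{k ≥ 0} E_{n+k}(σ)`, `E = physEnergy`).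

1. **The aside is implied-dead by every live child.**  The crux of record `TailRatchet` (uniform contraction
   `Θ_{n+1} ≤ (1 − w)·Θ_n`) implies, BY NAME, the repaired deciding crux `TailRateRatchet` (stmt-25584; the
   argument of the tree's `WakeRatchetRate.rateRatchet_of_tailRatchet`, exponent `a = 2`, restated here so that
   this file imports only the route file and a route-independent tool module) and hence both of its split
   children `EternalInviscidRate` (stmt-25646, the `ν̂ = 0` slice, via `IsEternal.isEternalVisc`) and
   `EternalViscousRate` (stmt-25647, the `ν̂ > 0` slice).  Contrapositives: a refutation of ANY of the three
   live statements closes stmt-21808 as refuted by a one-line application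
   (`not_tailRatchet_of_not_eternalInviscidRate`, `…_of_not_eternalViscousRate`, `…_of_not_tailRateRatchet`).
2. **Every tail ratchet is a finite-energy Liouville theorem.**  If the tails of ONE solution contract at every
   shell by a factor `q < 1` (`Θ_{n+1} ≤ q·M` whenever `Θ_n ≤ M` at all log-times) and are bounded UNIFORMLY IN
   THE SHELL (`Θ_n(σ) ≤ E` for all `n, σ` — i.e. the total physical energy `sup_n Θ_n = Σ_{k ∈ ℤ} E_k` is
   bounded in log-time; for `ν̂ = 0` it is conserved, so this says «finite energy»), then iterating the
   contraction DOWN the lattice gives `Θ_n ≤ q^j E` for every `j` (`tail_le_pow_mul_of_contraction`), hence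
   `W ≡ 0` (`eq_zero_of_contraction_of_boundedTails`).  Consequently `TailRatchet`, `TailRateRatchet`,
   `EternalInviscidRate` and `EternalViscousRate` each assert, below their threshold `ε_s(R)`, that NO
   non-trivial uniformly bounded admissible eternal solution of an `E₂(R)` table has finite total energy
   (`finiteEnergy_liouville_of_tailRatchet`, `…_of_tailRateRatchet`, `…_of_eternalInviscidRate`,
   `…_of_eternalViscousRate`).  (The witnesses that threaten these statements — discretely self-similar
   fronts — have infinite energy: their wake grows like `μ^{-|n|}` towards `n → −∞`; the finite-energy class is
   a second, disjoint stratum on which all four statements are Liouville claims.)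

HONEST FRAMING: statements about a MODEL lattice ODE (Tao 2016 §4, renormalised variables of §6.4); nothing
here concerns the Navier–Stokes equations; stmt-21808 is neither proved nor refuted here.
-/

noncomputable section

set_option linter.dupNamespace false

namespace Summit.NavierStokesRegularity.NavierStokesRegularity.Theorems

namespace WakeRatchetTailRatchetLive

open Filter Topology
open Literature.Analysis.FluidPDE Literature.Analysis.FluidPDE.TaoCascade
open Summit.NavierStokesRegularity.NavierStokesRegularity.Theses.WakeRatchet

/-! ## 1. The aside implies the live cruxes, by name -/

/-- **`TailRatchet → TailRateRatchet`** (stmt-21808 ⟹ stmt-25584), by name: the uniform contraction implies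
the rate contraction with exponent `a = 2` below the shrunk threshold (tree: `rateRatchet_of_tailRatchet`).
[cite: Tao2016AveragedNS, §4 Thm. 4.2 (statement shape); elementary] -/
theorem tailRateRatchet_of_tailRatchet (h : TailRatchet) : TailRateRatchet := by
  intro R hR
  obtain ⟨w, hw, εs, hεs, H⟩ := h R hR
  refine ⟨2, by norm_num, min εs (w / 2), lt_min hεs (by positivity), ?_⟩
  intro ε₀ hε₀ hle α hα νh W hW hU n M hM σ
  have hM0 : 0 ≤ M :=
    (tsum_nonneg fun k : ℕ => physEnergy_nonneg ε₀ W (n + (k : ℤ)) σ).trans (hM σ)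
  have h1 := H ε₀ hε₀ (hle.trans (min_le_left _ _)) α hα νh W hW hU n M hM σ
  refine h1.trans (mul_le_mul_of_nonneg_right ?_ hM0)
  -- `1 - w ≤ (1+ε₀)^{-2}` from `ε₀ ≤ w/2`: `(1 − w)(1 + w/2)² ≤ 1`
  have hb0 : 0 < 1 + ε₀ := by linarith
  have hεw : ε₀ ≤ w / 2 := hle.trans (min_le_right _ _)
  have e : (1 + ε₀) ^ (-(2 : ℝ)) = ((1 + ε₀) ^ 2)⁻¹ := by
    rw [Real.rpow_neg hb0.le, show (2 : ℝ) = ((2 : ℕ) : ℝ) by norm_num, Real.rpow_natCast]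
  have hpos : 0 < (1 + ε₀) ^ 2 := by positivity
  have key : (1 - w) * (1 + ε₀) ^ 2 ≤ 1 := by
    rcases le_or_gt w 1 with hw1 | hw1
    · have hsq : (1 + ε₀) ^ 2 ≤ (1 + w / 2) ^ 2 := pow_le_pow_left₀ hb0.le (by linarith) 2
      have h2 : (1 - w) * (1 + ε₀) ^ 2 ≤ (1 - w) * (1 + w / 2) ^ 2 :=
        mul_le_mul_of_nonneg_left hsq (by linarith)
      nlinarith [sq_nonneg w, hw.le]
    · nlinarith [hpos]
  rw [e, ← one_div]
  exact (le_div_iff₀ hpos).2 key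

/-- **`TailRateRatchet → EternalInviscidRate`** (stmt-25584 ⟹ stmt-25646): the `ν̂ = 0` slice, via
`IsEternal.isEternalVisc`. [cite: Tao2016AveragedNS, §4 Lemma 4.1 (iii) (4.8); elementary] -/
theorem eternalInviscidRate_of_tailRateRatchet (h : TailRateRatchet) : EternalInviscidRate := by
  intro R hR
  obtain ⟨a, ha, εs, hεs, H⟩ := h R hR
  exact ⟨a, ha, εs, hεs, fun ε₀ hε₀ hle α hα W hW hU n M hM σ =>
    H ε₀ hε₀ hle α hα 0 W hW.isEternalVisc hU n M hM σ⟩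

/-- **`TailRateRatchet → EternalViscousRate`** (stmt-25584 ⟹ stmt-25647): the `ν̂ > 0` slice (drop the sign
hypothesis). [cite: Tao2016AveragedNS, §4, the viscous equation before Thm. 4.2; elementary] -/
theorem eternalViscousRate_of_tailRateRatchet (h : TailRateRatchet) : EternalViscousRate := by
  intro R hR
  obtain ⟨a, ha, εs, hεs, H⟩ := h R hR
  exact ⟨a, ha, εs, hεs, fun ε₀ hε₀ hle α hα νh W _hν hW hU n M hM σ =>
    H ε₀ hε₀ hle α hα νh W hW hU n M hM σ⟩

/-- **`TailRatchet → EternalInviscidRate`** (stmt-21808 ⟹ stmt-25646), by name.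
[cite: Tao2016AveragedNS, §4 Thm. 4.2 (statement shape); elementary] -/
theorem eternalInviscidRate_of_tailRatchet (h : TailRatchet) : EternalInviscidRate :=
  eternalInviscidRate_of_tailRateRatchet (tailRateRatchet_of_tailRatchet h)

/-- **`TailRatchet → EternalViscousRate`** (stmt-21808 ⟹ stmt-25647), by name.
[cite: Tao2016AveragedNS, §4 Thm. 4.2 (statement shape); elementary] -/
theorem eternalViscousRate_of_tailRatchet (h : TailRatchet) : EternalViscousRate :=
  eternalViscousRate_of_tailRateRatchet (tailRateRatchet_of_tailRatchet h)

/-- **Kill by proxy (rate form).**  A refutation of the repaired crux stmt-25584 refutes the aside stmt-21808.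
[cite: Tao2016AveragedNS, §4 Thm. 4.2 (statement shape); elementary] -/
theorem not_tailRatchet_of_not_tailRateRatchet (h : ¬ TailRateRatchet) : ¬ TailRatchet :=
  fun hT => h (tailRateRatchet_of_tailRatchet hT)

/-- **Kill by proxy (inviscid child).**  A refutation of stmt-25646 refutes the aside stmt-21808.
[cite: Tao2016AveragedNS, §4 Thm. 4.2 (statement shape); elementary] -/
theorem not_tailRatchet_of_not_eternalInviscidRate (h : ¬ EternalInviscidRate) : ¬ TailRatchet :=
  fun hT => h (eternalInviscidRate_of_tailRatchet hT)

/-- **Kill by proxy (viscous child).**  A refutation of stmt-25647 refutes the aside stmt-21808.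
[cite: Tao2016AveragedNS, §4 Thm. 4.2 (statement shape); elementary] -/
theorem not_tailRatchet_of_not_eternalViscousRate (h : ¬ EternalViscousRate) : ¬ TailRatchet :=
  fun hT => h (eternalViscousRate_of_tailRatchet hT)

/-! ## 2. A tail contraction is a Liouville theorem on the finite-energy stratum -/

section Generic

variable {m : ℕ} {ε₀ : ℝ} {W : ℤ → ℝ → Em m}

/-- **Iterating a contraction DOWN the lattice.**  If at every shell a bound `M` on the tail `Θ_n` at all
log-times forces `Θ_{n+1} ≤ q·M`, and all tails are bounded by one constant `E` (uniformly in the shell),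
then `Θ_n ≤ q^j·E` for every `j` and every shell `n` (apply the hypothesis at shells `n−j, …, n−1`).
[cite: Tao2016AveragedNS, §4 Lemma 4.1 (4.10) (shell energies); elementary induction] -/
theorem tail_le_pow_mul_of_contraction {q E : ℝ}
    (hcontr : ∀ (n : ℤ) (M : ℝ), (∀ σ : ℝ, ∑' k : ℕ, physEnergy ε₀ W (n + k) σ ≤ M) →
      ∀ σ : ℝ, ∑' k : ℕ, physEnergy ε₀ W (n + 1 + k) σ ≤ q * M)
    (hE : ∀ (n : ℤ) (σ : ℝ), ∑' k : ℕ, physEnergy ε₀ W (n + k) σ ≤ E) :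
    ∀ (j : ℕ) (n : ℤ) (σ : ℝ), ∑' k : ℕ, physEnergy ε₀ W (n + k) σ ≤ q ^ j * E := by
  intro j
  induction j with
  | zero => intro n σ; simpa only [pow_zero, one_mul] using hE n σ
  | succ j ih =>
    intro n σ
    have h := hcontr (n - 1) (q ^ j * E) (ih (n - 1)) σ
    rw [sub_add_cancel] at h
    calc ∑' k : ℕ, physEnergy ε₀ W (n + k) σ ≤ q * (q ^ j * E) := h
      _ = q ^ (j + 1) * E := by ring

/-- A vanishing physical shell energy means a vanishing amplitude (`ε₀ > -1`).
[cite: Tao2016AveragedNS, §4 Lemma 4.1 (4.10) in the self-similar variables of §6.4; elementary] -/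
theorem eq_zero_of_physEnergy_eq_zero (hε : -1 < ε₀) {n : ℤ} {σ : ℝ}
    (h : physEnergy ε₀ W n σ = 0) : W n σ = 0 := by
  unfold physEnergy at h
  have hΛ : 0 < bigLam ε₀ := bigLam_pos hε
  have h1 : (bigLam ε₀ ^ n)⁻¹ ^ 2 ≠ 0 := by positivity
  have h2 : Real.exp (2 * σ) ≠ 0 := (Real.exp_pos _).ne'
  rcases mul_eq_zero.1 h with h' | h'
  · exact absurd h' h1
  · rcases mul_eq_zero.1 h' with h'' | h''
    · exact absurd h'' h2
    · exact norm_eq_zero.1 ((pow_eq_zero_iff two_ne_zero).1 h'')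

/-- **Contraction + uniformly bounded tails ⟹ trivial.**  Under a uniform amplitude bound, a per-shell tail
contraction with factor `q ∈ [0,1)` for ONE family `W` whose tails are bounded uniformly in the shell forces
`W ≡ 0`: `E_n(σ) ≤ Θ_n(σ) ≤ q^j E → 0`.
[cite: Tao2016AveragedNS, §4 Lemma 4.1 (4.10) in the self-similar variables of §6.4; elementary] -/
theorem eq_zero_of_contraction_of_boundedTails (hε : 0 < ε₀) (hU : UniformBound W) {q E : ℝ}
    (hq0 : 0 ≤ q) (hq1 : q < 1)
    (hcontr : ∀ (n : ℤ) (M : ℝ), (∀ σ : ℝ, ∑' k : ℕ, physEnergy ε₀ W (n + k) σ ≤ M) →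
      ∀ σ : ℝ, ∑' k : ℕ, physEnergy ε₀ W (n + 1 + k) σ ≤ q * M)
    (hE : ∀ (n : ℤ) (σ : ℝ), ∑' k : ℕ, physEnergy ε₀ W (n + k) σ ≤ E) :
    ∀ (n : ℤ) (σ : ℝ), W n σ = 0 := by
  intro n σ
  have h1 : ∀ j : ℕ, physEnergy ε₀ W n σ ≤ q ^ j * E := fun j =>
    (WakeRatchetTail.physEnergy_le_tail hε hU n σ).trans
      (tail_le_pow_mul_of_contraction hcontr hE j n σ)
  have hlim : Tendsto (fun j : ℕ => q ^ j * E) atTop (𝓝 (0 * E)) :=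
    (tendsto_pow_atTop_nhds_zero_of_lt_one hq0 hq1).mul_const E
  rw [zero_mul] at hlim
  have hle : physEnergy ε₀ W n σ ≤ 0 := ge_of_tendsto' hlim h1
  exact eq_zero_of_physEnergy_eq_zero (by linarith)
    (le_antisymm hle (physEnergy_nonneg ε₀ W n σ))

/-- The same with a contraction factor `1 − w`, `w > 0` of either size (a factor `≤ 0` kills at once, since
tails are non-negative). [cite: Tao2016AveragedNS, §4 Lemma 4.1 (4.10); elementary] -/
theorem eq_zero_of_wContraction_of_boundedTails (hε : 0 < ε₀) (hU : UniformBound W) {w E : ℝ}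
    (hw : 0 < w)
    (hcontr : ∀ (n : ℤ) (M : ℝ), (∀ σ : ℝ, ∑' k : ℕ, physEnergy ε₀ W (n + k) σ ≤ M) →
      ∀ σ : ℝ, ∑' k : ℕ, physEnergy ε₀ W (n + 1 + k) σ ≤ (1 - w) * M)
    (hE : ∀ (n : ℤ) (σ : ℝ), ∑' k : ℕ, physEnergy ε₀ W (n + k) σ ≤ E) :
    ∀ (n : ℤ) (σ : ℝ), W n σ = 0 := by
  -- weaken the factor to `q := 1 - min w (1/2) ∈ [1/2, 1)`, using `M ≥ Θ ≥ 0`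
  refine eq_zero_of_contraction_of_boundedTails hε hU (q := 1 - min w (1 / 2))
    (by have := min_le_right w (1 / 2); linarith) (by have := lt_min hw one_half_pos; linarith)
    (fun n M hM σ => ?_) hE
  have hM0 : 0 ≤ M :=
    (tsum_nonneg fun k : ℕ => physEnergy_nonneg ε₀ W (n + (k : ℤ)) σ).trans (hM σ)
  refine (hcontr n M hM σ).trans (mul_le_mul_of_nonneg_right ?_ hM0)
  linarith [min_le_left w (1 / 2)]

/-- The same with a rate factor `(1+ε₀)^{-a}`, `a > 0`, `ε₀ > 0`.
[cite: Tao2016AveragedNS, §4 (scale ratio `1+ε₀`), Lemma 4.1 (4.10); elementary] -/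
theorem eq_zero_of_rateContraction_of_boundedTails (hε : 0 < ε₀) (hU : UniformBound W) {a E : ℝ}
    (ha : 0 < a)
    (hcontr : ∀ (n : ℤ) (M : ℝ), (∀ σ : ℝ, ∑' k : ℕ, physEnergy ε₀ W (n + k) σ ≤ M) →
      ∀ σ : ℝ, ∑' k : ℕ, physEnergy ε₀ W (n + 1 + k) σ ≤ (1 + ε₀) ^ (-a) * M)
    (hE : ∀ (n : ℤ) (σ : ℝ), ∑' k : ℕ, physEnergy ε₀ W (n + k) σ ≤ E) :
    ∀ (n : ℤ) (σ : ℝ), W n σ = 0 := by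
  have h1 : 1 < 1 + ε₀ := by linarith
  refine eq_zero_of_contraction_of_boundedTails hε hU (q := (1 + ε₀) ^ (-a))
    (Real.rpow_nonneg (by linarith) _) ?_ hcontr hE
  exact Real.rpow_lt_one_of_one_lt_of_neg h1 (by linarith)

end Generic

/-! ### The four route statements as finite-energy Liouville theorems -/

/-- **`TailRatchet` ⟹ finite-energy Liouville.**  Below its threshold, on every `E₂(R)` table and at every
covariant viscosity `ν̂ ≥ 0`, the only uniformly bounded admissible eternal solution whose total physical
energy is bounded in log-time (tails bounded uniformly in the shell) is `W ≡ 0`.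
[cite: Tao2016AveragedNS, §4 Thm. 4.2 (statement shape), Lemma 4.1 (4.10); cell bookkeeping] -/
theorem finiteEnergy_liouville_of_tailRatchet (h : TailRatchet) :
    ∀ R : ℝ, 1 ≤ R → ∃ εs : ℝ, 0 < εs ∧ ∀ ε₀ : ℝ, 0 < ε₀ → ε₀ ≤ εs →
      ∀ α : Fin 4 → Fin 4 → Fin 4 → ℤ × ℤ × ℤ → ℝ, InTableClass R α →
        ∀ (νh : ℝ) (W : ℤ → ℝ → Em 4), IsEternalVisc ε₀ νh α W → UniformBound W →
          (∃ E : ℝ, ∀ (n : ℤ) (σ : ℝ), ∑' k : ℕ, physEnergy ε₀ W (n + k) σ ≤ E) →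
            ∀ (n : ℤ) (σ : ℝ), W n σ = 0 := by
  intro R hR
  obtain ⟨w, hw, εs, hεs, H⟩ := h R hR
  refine ⟨εs, hεs, fun ε₀ hε₀ hle α hα νh W hW hU hfin => ?_⟩
  obtain ⟨E, hE⟩ := hfin
  exact eq_zero_of_wContraction_of_boundedTails hε₀ hU hw (H ε₀ hε₀ hle α hα νh W hW hU) hE

/-- **`TailRateRatchet` (stmt-25584) ⟹ finite-energy Liouville** (same reading for the repaired crux).
[cite: Tao2016AveragedNS, §4 Thm. 4.2 (statement shape), Lemma 4.1 (4.10); cell bookkeeping] -/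
theorem finiteEnergy_liouville_of_tailRateRatchet (h : TailRateRatchet) :
    ∀ R : ℝ, 1 ≤ R → ∃ εs : ℝ, 0 < εs ∧ ∀ ε₀ : ℝ, 0 < ε₀ → ε₀ ≤ εs →
      ∀ α : Fin 4 → Fin 4 → Fin 4 → ℤ × ℤ × ℤ → ℝ, InTableClass R α →
        ∀ (νh : ℝ) (W : ℤ → ℝ → Em 4), IsEternalVisc ε₀ νh α W → UniformBound W →
          (∃ E : ℝ, ∀ (n : ℤ) (σ : ℝ), ∑' k : ℕ, physEnergy ε₀ W (n + k) σ ≤ E) →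
            ∀ (n : ℤ) (σ : ℝ), W n σ = 0 := by
  intro R hR
  obtain ⟨a, ha, εs, hεs, H⟩ := h R hR
  refine ⟨εs, hεs, fun ε₀ hε₀ hle α hα νh W hW hU hfin => ?_⟩
  obtain ⟨E, hE⟩ := hfin
  exact eq_zero_of_rateContraction_of_boundedTails hε₀ hU (by linarith)
    (H ε₀ hε₀ hle α hα νh W hW hU) hE

/-- **`EternalInviscidRate` (stmt-25646) ⟹ finite-energy Liouville for INVISCID bounded eternal solutions.**
[cite: Tao2016AveragedNS, §4 Thm. 4.2 (statement shape), Lemma 4.1 (4.10); cell bookkeeping] -/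
theorem finiteEnergy_liouville_of_eternalInviscidRate (h : EternalInviscidRate) :
    ∀ R : ℝ, 1 ≤ R → ∃ εs : ℝ, 0 < εs ∧ ∀ ε₀ : ℝ, 0 < ε₀ → ε₀ ≤ εs →
      ∀ α : Fin 4 → Fin 4 → Fin 4 → ℤ × ℤ × ℤ → ℝ, InTableClass R α →
        ∀ W : ℤ → ℝ → Em 4, IsEternal ε₀ α W → UniformBound W →
          (∃ E : ℝ, ∀ (n : ℤ) (σ : ℝ), ∑' k : ℕ, physEnergy ε₀ W (n + k) σ ≤ E) →
            ∀ (n : ℤ) (σ : ℝ), W n σ = 0 := by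
  intro R hR
  obtain ⟨a, ha, εs, hεs, H⟩ := h R hR
  refine ⟨εs, hεs, fun ε₀ hε₀ hle α hα W hW hU hfin => ?_⟩
  obtain ⟨E, hE⟩ := hfin
  exact eq_zero_of_rateContraction_of_boundedTails hε₀ hU (by linarith)
    (H ε₀ hε₀ hle α hα W hW hU) hE

/-- **`EternalViscousRate` (stmt-25647) ⟹ finite-energy Liouville for VISCOUS (`ν̂ > 0`) bounded eternal
solutions** (here «finite energy» = total physical energy bounded in log-time; it is not conserved).
[cite: Tao2016AveragedNS, §4, the viscous equation before Thm. 4.2, Lemma 4.1 (4.10); cell bookkeeping] -/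
theorem finiteEnergy_liouville_of_eternalViscousRate (h : EternalViscousRate) :
    ∀ R : ℝ, 1 ≤ R → ∃ εs : ℝ, 0 < εs ∧ ∀ ε₀ : ℝ, 0 < ε₀ → ε₀ ≤ εs →
      ∀ α : Fin 4 → Fin 4 → Fin 4 → ℤ × ℤ × ℤ → ℝ, InTableClass R α →
        ∀ (νh : ℝ) (W : ℤ → ℝ → Em 4), 0 < νh → IsEternalVisc ε₀ νh α W → UniformBound W →
          (∃ E : ℝ, ∀ (n : ℤ) (σ : ℝ), ∑' k : ℕ, physEnergy ε₀ W (n + k) σ ≤ E) →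
            ∀ (n : ℤ) (σ : ℝ), W n σ = 0 := by
  intro R hR
  obtain ⟨a, ha, εs, hεs, H⟩ := h R hR
  refine ⟨εs, hεs, fun ε₀ hε₀ hle α hα νh W hν hW hU hfin => ?_⟩
  obtain ⟨E, hE⟩ := hfin
  exact eq_zero_of_rateContraction_of_boundedTails hε₀ hU (by linarith)
    (H ε₀ hε₀ hle α hα νh W hν hW hU) hE

end WakeRatchetTailRatchetLive

end Summit.NavierStokesRegularity.NavierStokesRegularity.Theorems

end
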